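import Summits.NavierStokesRegularity.FunctionalMining.StretchingNestedTargets
import HarnessLib

/-!
# FunctionalMining — K1-Q1: the bank's LIMIT-FREE wrap node and its assemblies, typed (dict seat, staged)

NS FUNCTIONAL MINING cell (`pub-nsfunc`), dictionary seat gen 7 — **search for candidate a priori
estimates; no regularity claim.** STATIC field inequalities only: nothing about Navier–Stokes solutions
is asserted anywhere in this file.

Source: bank seat gen 4, `pub-nsfunc-bank/WRAP-KERNEL-BLUEPRINT.md` (2026-08-20T05:04Z) [ours, internal,
UNREVIEWED beyond the cell]. The bank observed that the single node `WrapLowerBound` of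
`StretchingNestedTargets.lean` (true, but whose kernel proof hides three analytic engines: a periodic vector
potential, two-scale limits, plateau limits) separates into

* **N1 `WrapIdentityBound`** — LIMIT-FREE and POTENTIAL-FREE: for two smooth divergence-free fields `u₊`,
  `u₋` supported in the two plateau boxes of the diagonal crossed-shear flow and with `|ω| ≤ 1`, every valid
  K1-Q1 constant `C` satisfies `Λ(T₁₁−T₂₂)(u₊) + Λ(T₂₂−T₁₁)(u₋) + σ(u₊) + σ(u₋) ≤ C(Λ² + ℰ(u₊) + ℰ(u₋))`
  (pure support bookkeeping + two exact identities; the bank gives a complete hand proof, blueprint §2–§3);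
* **`ConfinedPlus` / `ConfinedMinus`** — the existence of such confined fields with the planar filler's
  statistics times the box volume `1/4` (`σ ≥ 1/16 − ε`, `ℰ ≤ 1/8 + ε`, moment gap `≥ 1/16 − ε`), which the
  blueprint derives (assembly A1) from **N2 `ConfinementLemma`** (all `m → ∞` limits, stated at potential
  level), **N3± `PlanarFillerFamilyPot`** (bank Theorem 1's family with an explicit vector potential) and
  **N4 `PlateauEnvelope`**.

This file TYPES N1–N4 and the two confined-field nodes as `@[conjecture]` obligation nodes (internal hand
theorems, UNPROVED in the kernel — LEAN PLACEMENT RULE: they are ours, not literature facts) and PROVES the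
assemblies in the kernel:

* `nestedLowerBound_of_wrapIdentity : WrapIdentityBound → ConfinedPlus → ConfinedMinus → NestedLowerBound`
  (blueprint A3: `(2+√5)/8 ≤ C⋆`, reusing `wrapFloor` of `StretchingNestedTargets`);
* `oneSided_le_stretchingSupConst_of_wrapIdentity : WrapIdentityBound → ConfinedPlus → (4+3√2)/16 ≤ C⋆`
  (blueprint A2, NEW one-sided variant: loading only the `+` strain cells already beats `1/2`), whence
  `stretchingSupConstOn_isTwoHalfD_lt_of_oneSided : … → C_{2.5D} < C⋆` — the MINIMAL kernel route to the
  strict separation of the 2½-D class constant from `C⋆` (no mirrored filler copy needed);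
* `confinedPlus_of_confinement : ConfinementLemma → PlanarFillerFamilyPotPlus → PlateauEnvelope → ConfinedPlus`
  and its mirror (blueprint A1, ε-bookkeeping).

Nothing here claims a value of `C⋆`; all nodes are flagged as open obligations. Search for candidate a priori
estimates; no regularity claim. [ours]
-/

noncomputable section

open Set Filter Topology MeasureTheory

namespace Summit.NavierStokesRegularity.FunctionalMining

open Literature.Analysis Literature.Analysis.FunctionSpaces Literature.Analysis.FunctionSpaces.Torus
open Literature.Analysis.FluidPDE

/-! ## 1. Plateau arcs and the two strain boxes of the diagonal crossed-shear flow -/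

/-- `y ∈ T¹` lies on the plateau arc `[δ, 1/2 − δ]` (image of the real interval under `ℝ → T¹`). [ours; bookkeeping] -/
def inArc (δ : ℝ) (y : UnitAddCircle) : Prop :=
  ∃ t ∈ Icc δ (1 / 2 - δ), ((t : ℝ) : UnitAddCircle) = y

/-- The `+ΛD` strain box: `x₁ + x₂` and `x₁ − x₂` both on the arc `[δ, 1/2 − δ]` (`0`-indexed coordinates as
in `vorticityComp`; `x₀` is the neutral axis). [ours; bookkeeping] -/
def boxPlus (δ : ℝ) : Set (UnitAddTorus (Fin 3)) :=
  {x | inArc δ (x 1 + x 2) ∧ inArc δ (x 1 - x 2)}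

/-- The `−ΛD` strain box: `boxPlus` translated by `1/2` in both diagonal variables. [ours; bookkeeping] -/
def boxMinus (δ : ℝ) : Set (UnitAddTorus (Fin 3)) :=
  {x | inArc δ (x 1 + x 2 + (((1 : ℝ) / 2 : ℝ) : UnitAddCircle)) ∧
    inArc δ (x 1 - x 2 + (((1 : ℝ) / 2 : ℝ) : UnitAddCircle))}

/-- `inArc.mono` (bookkeeping). [ours; elementary] -/
theorem inArc.mono {δ δ' : ℝ} (h : δ' ≤ δ) {y : UnitAddCircle} (hy : inArc δ y) : inArc δ' y := by
  obtain ⟨t, ht, rfl⟩ := hy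
  exact ⟨t, ⟨h.trans ht.1, ht.2.trans (by linarith)⟩, rfl⟩

/-- Smaller `δ` = larger box. [ours; elementary] -/
theorem boxPlus_mono {δ δ' : ℝ} (h : δ' ≤ δ) : boxPlus δ ⊆ boxPlus δ' :=
  fun _ hx => ⟨hx.1.mono h, hx.2.mono h⟩

/-- `boxMinus_mono` (bookkeeping). [ours; elementary] -/
theorem boxMinus_mono {δ δ' : ℝ} (h : δ' ≤ δ) : boxMinus δ ⊆ boxMinus δ' :=
  fun _ hx => ⟨hx.1.mono h, hx.2.mono h⟩

/-- The arc is compact, hence closed. [ours; elementary] -/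
theorem isClosed_setOf_inArc (δ : ℝ) : IsClosed {y : UnitAddCircle | inArc δ y} := by
  have : {y : UnitAddCircle | inArc δ y} = (fun t : ℝ => ((t : ℝ) : UnitAddCircle)) '' Icc δ (1 / 2 - δ) := by
    ext y; simp [inArc]
  rw [this]
  exact (isCompact_Icc.image (AddCircle.continuous_mk' (1 : ℝ))).isClosed

/-- `isClosed_boxPlus` (bookkeeping). [ours; elementary] -/
theorem isClosed_boxPlus (δ : ℝ) : IsClosed (boxPlus δ) := by
  have h1 : Continuous fun x : UnitAddTorus (Fin 3) => x 1 + x 2 := by fun_prop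
  have h2 : Continuous fun x : UnitAddTorus (Fin 3) => x 1 - x 2 := by fun_prop
  exact ((isClosed_setOf_inArc δ).preimage h1).inter ((isClosed_setOf_inArc δ).preimage h2)

/-- `isClosed_boxMinus` (bookkeeping). [ours; elementary] -/
theorem isClosed_boxMinus (δ : ℝ) : IsClosed (boxMinus δ) := by
  have h1 : Continuous fun x : UnitAddTorus (Fin 3) =>
      x 1 + x 2 + (((1 : ℝ) / 2 : ℝ) : UnitAddCircle) := by fun_prop
  have h2 : Continuous fun x : UnitAddTorus (Fin 3) =>
      x 1 - x 2 + (((1 : ℝ) / 2 : ℝ) : UnitAddCircle) := by fun_prop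
  exact ((isClosed_setOf_inArc δ).preimage h1).inter ((isClosed_setOf_inArc δ).preimage h2)

/-! ## 2. The nodes (bank WRAP-KERNEL-BLUEPRINT §1; all [ours], internal hand theorems, UNPROVED in the kernel) -/

/-- **N1 (bank blueprint §1–§3): the LIMIT-FREE wrap identity bound.** For `Λ ∈ (0, 1/2]`, `δ ∈ (0, 1/16)`
and smooth divergence-free `u₊`, `u₋` vanishing off `boxPlus 2δ`, `boxMinus 2δ` respectively, with
`|ω(u±)|² ≤ 1` pointwise: every `C ≥ 0` with `StretchingSupBound C` satisfies
`Λ(T₁₁−T₂₂)(u₊) + Λ(T₂₂−T₁₁)(u₋) + σ(u₊) + σ(u₋) ≤ C(Λ² + ℰ(u₊) + ℰ(u₋))`. Bank proof: glue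
`u := v₂ + u₊ + u₋` with the diagonal crossed-shear flow `v₂ = f(x₁+x₂)t_A + f(x₁−x₂)t_B` (smooth plateau
profile via `Real.smoothTransition ∘ sin`), whose strain is EXACTLY `±ΛD` and whose vorticity VANISHES on the
boxes; pointwise three-case analysis gives `ωᵀSω` and `|ω|² ≤ 1` exactly; integrate; `½∫|ω₂|² ≤ Λ²` by the
Haar push-forward of `(x₁,x₂) ↦ (x₁±x₂)`. No limits, no potentials. Internal hand theorem, UNPROVED in the
kernel. Search for candidate a priori estimates; no regularity claim. [ours] -/
@[conjecture] def WrapIdentityBound : Prop :=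
  ∀ Λ : ℝ, 0 < Λ → Λ ≤ 1 / 2 → ∀ δ : ℝ, 0 < δ → δ < 1 / 16 →
    ∀ up um : UnitAddTorus (Fin 3) → EuclideanSpace ℝ (Fin 3),
      Torus.IsSmooth up → Torus.IsDivFree up → Torus.IsSmooth um → Torus.IsDivFree um →
      (∀ x ∉ boxPlus (2 * δ), up x = 0) → (∀ x ∉ boxMinus (2 * δ), um x = 0) →
      (∀ x, torusVorticitySqAt up x ≤ 1) → (∀ x, torusVorticitySqAt um x ≤ 1) →
      ∀ C : ℝ, 0 ≤ C → StretchingSupBound (d := Fin 3) C →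
        Λ * (vorticityMoment up 1 1 - vorticityMoment up 2 2) +
            Λ * (vorticityMoment um 2 2 - vorticityMoment um 1 1) +
            enstrophyProduction up + enstrophyProduction um ≤
          C * (Λ ^ 2 + torusEnstrophy up + torusEnstrophy um)

/-- **ConfinedPlus (bank blueprint A1 output): planar-filler statistics confined to the `+` box.** For every
`ε > 0` there are `δ ∈ (0,1/16)` and a smooth divergence-free `u₊` vanishing off `boxPlus 2δ` with `|ω|² ≤ 1`,
`σ(u₊) ≥ 1/16 − ε`, `ℰ(u₊) ≤ 1/8 + ε`, `T₁₁(u₊) − T₂₂(u₊) ≥ 1/16 − ε` (filler statistics `1/4, 1/2, 1/4`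
times the box volume `→ 1/4`). Internal, UNPROVED in the kernel (`confinedPlus_of_confinement` derives it from
N2–N4). Search for candidate a priori estimates; no regularity claim. [ours] -/
@[conjecture] def ConfinedPlus : Prop :=
  ∀ ε : ℝ, 0 < ε → ∃ δ : ℝ, 0 < δ ∧ δ < 1 / 16 ∧
    ∃ u : UnitAddTorus (Fin 3) → EuclideanSpace ℝ (Fin 3),
      Torus.IsSmooth u ∧ Torus.IsDivFree u ∧ (∀ x ∉ boxPlus (2 * δ), u x = 0) ∧
      (∀ x, torusVorticitySqAt u x ≤ 1) ∧ 1 / 16 - ε ≤ enstrophyProduction u ∧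
      torusEnstrophy u ≤ 1 / 8 + ε ∧ 1 / 16 - ε ≤ vorticityMoment u 1 1 - vorticityMoment u 2 2

/-- **ConfinedMinus**: the mirror statement in the `−` box, with the moment gap reversed
(`T₂₂ − T₁₁ ≥ 1/16 − ε`: tubes along `e₂`). Internal, UNPROVED in the kernel. Search for candidate a priori
estimates; no regularity claim. [ours] -/
@[conjecture] def ConfinedMinus : Prop :=
  ∀ ε : ℝ, 0 < ε → ∃ δ : ℝ, 0 < δ ∧ δ < 1 / 16 ∧
    ∃ u : UnitAddTorus (Fin 3) → EuclideanSpace ℝ (Fin 3),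
      Torus.IsSmooth u ∧ Torus.IsDivFree u ∧ (∀ x ∉ boxMinus (2 * δ), u x = 0) ∧
      (∀ x, torusVorticitySqAt u x ≤ 1) ∧ 1 / 16 - ε ≤ enstrophyProduction u ∧
      torusEnstrophy u ≤ 1 / 8 + ε ∧ 1 / 16 - ε ≤ vorticityMoment u 2 2 - vorticityMoment u 1 1

/-- The curl of a (potential) field as a FIELD on `T³` (components = `vorticityComp`). [ours; bookkeeping] -/
def curlField (A : UnitAddTorus (Fin 3) → EuclideanSpace ℝ (Fin 3)) :
    UnitAddTorus (Fin 3) → EuclideanSpace ℝ (Fin 3) :=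
  fun x => WithLp.toLp 2 (vorticityComp A x)

/-- **N2 (bank blueprint §5): CONFINEMENT LEMMA at potential level** — where ALL `m → ∞` limits live. For a
smooth potential `𝒜` with `F := curl 𝒜`, `|curl F|² ≤ 1`, and a smooth envelope `0 ≤ E ≤ 1`: for every
`ε′ > 0` there is a smooth divergence-free `u` (bank: `u = λ_m · curl(E·m⁻²𝒜(m·))`, `m` large) which vanishes on
every open set where `E ≡ 0`, has `|ω(u)|² ≤ 1` EXACTLY (rescaling `λ_m = (1+K/m)⁻¹`), and whose statistics
are within `ε′` of `ℰ(F)∫E²`, `σ(F)∫E³`, `T_ii(F)∫E²` (`i = 1, 2`) (two-scale lemma by `mFourierBasis`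
Parseval + `ℓ²` tail; no rates). Internal hand theorem, UNPROVED in the kernel. Search for candidate a priori
estimates; no regularity claim. [ours] -/
@[conjecture] def ConfinementLemma : Prop :=
  ∀ A : UnitAddTorus (Fin 3) → EuclideanSpace ℝ (Fin 3), Torus.IsSmooth A →
    (∀ x, torusVorticitySqAt (curlField A) x ≤ 1) →
    ∀ E : UnitAddTorus (Fin 3) → ℝ, Torus.IsSmooth E → (∀ x, 0 ≤ E x ∧ E x ≤ 1) →
    ∀ ε' : ℝ, 0 < ε' → ∃ u : UnitAddTorus (Fin 3) → EuclideanSpace ℝ (Fin 3),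
      Torus.IsSmooth u ∧ Torus.IsDivFree u ∧
      (∀ O : Set (UnitAddTorus (Fin 3)), IsOpen O → (∀ x ∈ O, E x = 0) → ∀ x ∈ O, u x = 0) ∧
      (∀ x, torusVorticitySqAt u x ≤ 1) ∧
      |torusEnstrophy u - torusEnstrophy (curlField A) * ∫ x, E x ^ 2| ≤ ε' ∧
      |enstrophyProduction u - enstrophyProduction (curlField A) * ∫ x, E x ^ 3| ≤ ε' ∧
      |vorticityMoment u 1 1 - vorticityMoment (curlField A) 1 1 * ∫ x, E x ^ 2| ≤ ε' ∧
      |vorticityMoment u 2 2 - vorticityMoment (curlField A) 2 2 * ∫ x, E x ^ 2| ≤ ε'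

/-- **N3+ (bank blueprint §6): the planar filler WITH AN EXPLICIT POTENTIAL, tubes along `e₁`.** For every
`ε > 0` a smooth potential `𝒜` whose curl `F` has `|curl F|² ≤ 1`, `σ(F) ≥ 1/4 − ε`, `ℰ(F) ≤ 1/2 + ε`,
`T₁₁(F) − T₂₂(F) ≥ 1/4 − ε` (bank Theorem 1's family re-parametrised: `𝒜 = χe₁ − Ψe₂`, wave `w := ∂₀Ψ`).
Internal hand theorem, UNPROVED in the kernel. Search for candidate a priori estimates; no regularity claim. [ours] -/
@[conjecture] def PlanarFillerFamilyPotPlus : Prop :=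
  ∀ ε : ℝ, 0 < ε → ∃ A : UnitAddTorus (Fin 3) → EuclideanSpace ℝ (Fin 3), Torus.IsSmooth A ∧
    (∀ x, torusVorticitySqAt (curlField A) x ≤ 1) ∧
    1 / 4 - ε ≤ enstrophyProduction (curlField A) ∧ torusEnstrophy (curlField A) ≤ 1 / 2 + ε ∧
    1 / 4 - ε ≤ vorticityMoment (curlField A) 1 1 - vorticityMoment (curlField A) 2 2

/-- **N3−**: the same with tubes along `e₂` (`T₂₂(F) − T₁₁(F) ≥ 1/4 − ε`; N3+ with `x₁ ↔ x₂`). Internal,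
UNPROVED in the kernel. Search for candidate a priori estimates; no regularity claim. [ours] -/
@[conjecture] def PlanarFillerFamilyPotMinus : Prop :=
  ∀ ε : ℝ, 0 < ε → ∃ A : UnitAddTorus (Fin 3) → EuclideanSpace ℝ (Fin 3), Torus.IsSmooth A ∧
    (∀ x, torusVorticitySqAt (curlField A) x ≤ 1) ∧
    1 / 4 - ε ≤ enstrophyProduction (curlField A) ∧ torusEnstrophy (curlField A) ≤ 1 / 2 + ε ∧
    1 / 4 - ε ≤ vorticityMoment (curlField A) 2 2 - vorticityMoment (curlField A) 1 1

/-- **N4 (bank blueprint §4): plateau envelopes of the two boxes.** For `δ ∈ (0, 1/16)`: smooth `E₊`, `E₋`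
with values in `[0,1]`, `E₊ ≡ 0` off `boxPlus 2δ`, `E₋ ≡ 0` off `boxMinus 2δ`, and
`(1/2 − 6δ)² ≤ ∫E³ ≤ ∫E² ≤ (1/2 − 4δ)²` for both (bank: `E₊ = η(x₁+x₂)η(x₁−x₂)`,
`η = smoothTransition((sin 2πy − s₁)/(s₂ − s₁))`, Haar push-forward). Internal, UNPROVED in the kernel
(cf. the literature's `Torus.exists_plateau_cutoff` for the qualitative part). Search for candidate a priori
estimates; no regularity claim. [ours] -/
@[conjecture] def PlateauEnvelope : Prop :=
  ∀ δ : ℝ, 0 < δ → δ < 1 / 16 →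
    (∃ E : UnitAddTorus (Fin 3) → ℝ, Torus.IsSmooth E ∧ (∀ x, 0 ≤ E x ∧ E x ≤ 1) ∧
      (∀ x ∉ boxPlus (2 * δ), E x = 0) ∧
      (1 / 2 - 6 * δ) ^ 2 ≤ ∫ x, E x ^ 3 ∧ (∫ x, E x ^ 3) ≤ ∫ x, E x ^ 2 ∧
      (∫ x, E x ^ 2) ≤ (1 / 2 - 4 * δ) ^ 2) ∧
    (∃ E : UnitAddTorus (Fin 3) → ℝ, Torus.IsSmooth E ∧ (∀ x, 0 ≤ E x ∧ E x ≤ 1) ∧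
      (∀ x ∉ boxMinus (2 * δ), E x = 0) ∧
      (1 / 2 - 6 * δ) ^ 2 ≤ ∫ x, E x ^ 3 ∧ (∫ x, E x ^ 3) ≤ ∫ x, E x ^ 2 ∧
      (∫ x, E x ^ 2) ≤ (1 / 2 - 4 * δ) ^ 2)

/-! ## 3. Assembly A3: `WrapIdentityBound → ConfinedPlus → ConfinedMinus → (2+√5)/8 ≤ C⋆` -/

/-- A valid K1-Q1 constant is nonnegative (the tree's planar family kills every `C < √3/9`). [ours; elementary] -/
theorem StretchingSupBound.nonneg {C : ℝ} (h : StretchingSupBound (d := Fin 3) C) : 0 ≤ C := by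
  by_contra hC
  exact StretchFamily.not_stretchingSupBound_of_lt_sqrt_three_div_nine
    ((not_le.1 hC).trans (by positivity)) h

/-- **Two-sided wrap inequality at tolerance `ε`:** for `0 < ε` and every valid `C`,
`wrapFloor ε ≤ C` (N1 at `Λ⋆` with the confined fields at tolerance `ε/4`, common `δ := min δ₊ δ₋`).
[ours] -/
theorem wrapFloor_le_of_wrapIdentity (hW : WrapIdentityBound) (hP : ConfinedPlus) (hM : ConfinedMinus)
    {ε : ℝ} (hε : 0 < ε) {C : ℝ} (hB : StretchingSupBound (d := Fin 3) C) :
    wrapFloor ε ≤ C := by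
  have hC := hB.nonneg
  obtain ⟨δp, hδp, hδp', up, hup, hupd, hups, hupω, hupσ, hupE, hupT⟩ := hP (ε / 4) (by positivity)
  obtain ⟨δm, hδm, hδm', um, hum, humd, hums, humω, humσ, humE, humT⟩ := hM (ε / 4) (by positivity)
  set δ := min δp δm with hδ
  have hδ0 : 0 < δ := lt_min hδp hδm
  have hδ1 : δ < 1 / 16 := (min_le_left _ _).trans_lt hδp'
  have hups' : ∀ x ∉ boxPlus (2 * δ), up x = 0 := fun x hx =>
    hups x fun hx' => hx (boxPlus_mono (by linarith [min_le_left δp δm]) hx')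
  have hums' : ∀ x ∉ boxMinus (2 * δ), um x = 0 := fun x hx =>
    hums x fun hx' => hx (boxMinus_mono (by linarith [min_le_right δp δm]) hx')
  have key := hW lambdaStar lambdaStar_pos lambdaStar_le_half δ hδ0 hδ1 up um hup hupd hum humd
    hups' hums' hupω humω C hC hB
  have hΛ := lambdaStar_pos
  have hD' : 0 < 2 * (lambdaStar ^ 2 + 1 / 4 + ε / 2) := by positivity
  unfold wrapFloor
  rw [div_le_iff₀ hD']
  have hEp := torusEnstrophy_nonneg up
  have hEm := torusEnstrophy_nonneg um
  nlinarith [mul_le_mul_of_nonneg_left hupT hΛ.le, mul_le_mul_of_nonneg_left humT hΛ.le,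
    mul_le_mul_of_nonneg_left (add_le_add hupE humE) hC]

/-- **A3 (bank blueprint §7): `WrapIdentityBound → ConfinedPlus → ConfinedMinus → (2+√5)/8 ≤ C⋆`**, i.e.
`NestedLowerBound`, assembled in the kernel (`wrapFloor ε ≤ C` for every valid `C` and small `ε`,
`wrapFloor` continuous at `0` with value `(2+√5)/8`). Search for candidate a priori estimates; no regularity
claim. [ours] -/
theorem nestedLowerBound_of_wrapIdentity (hW : WrapIdentityBound) (hP : ConfinedPlus)
    (hM : ConfinedMinus) : NestedLowerBound := by
  unfold NestedLowerBound
  refine le_of_forall_lt_imp_le_of_dense fun C hC => le_stretchingSupConst fun hB => ?_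
  have ht : Tendsto wrapFloor (𝓝[>] 0) (𝓝 (wrapFloor 0)) :=
    continuousAt_wrapFloor_zero.tendsto.mono_left nhdsWithin_le_nhds
  have hle : wrapFloor 0 ≤ C := by
    refine le_of_tendsto ht ?_
    filter_upwards [Ioc_mem_nhdsGT (by norm_num : (0 : ℝ) < 1 / 8)] with ε hε
    exact wrapFloor_le_of_wrapIdentity hW hP hM hε.1 hB
  rw [wrapFloor_zero] at hle
  exact absurd (hC.trans_le hle) (lt_irrefl C)

/-! ## 4. Assembly A2 (one-sided, NEW): `WrapIdentityBound → ConfinedPlus → (4+3√2)/16 ≤ C⋆ ⇒ C_{2.5D} < C⋆` -/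

/-- The one-sided optimum `Λ₊ = (3√2 − 4)/4 ≈ 0.0607` of `r₊(Λ) = (1+Λ)/(16Λ²+2)`. [ours] -/
def lambdaPlus : ℝ := (3 * Real.sqrt 2 - 4) / 4

/-- `lambdaPlus_pos` (bookkeeping). [ours; elementary] -/
theorem lambdaPlus_pos : 0 < lambdaPlus := by
  unfold lambdaPlus
  have : (4 : ℝ) < 3 * Real.sqrt 2 := by
    have h2 : Real.sqrt 2 * Real.sqrt 2 = 2 := Real.mul_self_sqrt (by norm_num)
    nlinarith [Real.sqrt_nonneg 2]
  linarith

/-- `lambdaPlus_le_half` (bookkeeping). [ours; elementary] -/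
theorem lambdaPlus_le_half : lambdaPlus ≤ 1 / 2 := by
  unfold lambdaPlus
  have h2 : Real.sqrt 2 * Real.sqrt 2 = 2 := Real.mul_self_sqrt (by norm_num)
  nlinarith [Real.sqrt_nonneg 2]

/-- The one-sided guaranteed ratio at tolerance `ε`:
`ρ₊(ε) := [Λ₊(1/16 − ε) + (1/16 − ε)] / (Λ₊² + 1/8 + ε)`. [ours] -/
def wrapFloorPlus (ε : ℝ) : ℝ :=
  (lambdaPlus * (1 / 16 - ε) + (1 / 16 - ε)) / (lambdaPlus ^ 2 + 1 / 8 + ε)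

/-- `ρ₊(0) = (1+Λ₊)/(16Λ₊²+2) = (4+3√2)/16 ≈ 0.5152`. [ours; elementary] -/
theorem wrapFloorPlus_zero : wrapFloorPlus 0 = (4 + 3 * Real.sqrt 2) / 16 := by
  have h2 : Real.sqrt 2 * Real.sqrt 2 = 2 := Real.mul_self_sqrt (by norm_num)
  have hden : 0 < lambdaPlus ^ 2 + 1 / 8 + 0 := by positivity
  unfold wrapFloorPlus
  rw [div_eq_div_iff hden.ne' (by norm_num)]
  unfold lambdaPlus
  nlinarith [h2]

/-- `continuousAt_wrapFloorPlus_zero` (bookkeeping). [ours; elementary] -/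
theorem continuousAt_wrapFloorPlus_zero : ContinuousAt wrapFloorPlus 0 := by
  unfold wrapFloorPlus
  have hden : (lambdaPlus ^ 2 + 1 / 8 + (0 : ℝ)) ≠ 0 := by positivity
  exact ContinuousAt.div (by fun_prop) (by fun_prop) hden

/-- Zero-field bookkeeping for the one-sided instance of N1. [ours; elementary] -/
theorem torusVorticitySqAt_zero_field (x : UnitAddTorus (Fin 3)) :
    torusVorticitySqAt (fun _ : UnitAddTorus (Fin 3) => (0 : EuclideanSpace ℝ (Fin 3))) x = 0 := by
  simp [torusVorticitySqAt, Torus.partialDeriv, Torus.lineDeriv]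

/-- `vorticityComp_zero_field` (bookkeeping). [ours; elementary] -/
theorem vorticityComp_zero_field (x : UnitAddTorus (Fin 3)) :
    vorticityComp (fun _ : UnitAddTorus (Fin 3) => (0 : EuclideanSpace ℝ (Fin 3))) x = 0 := by
  ext i
  fin_cases i <;> simp [vorticityComp, Torus.partialDeriv, Torus.lineDeriv]

/-- `vorticityMoment_zero_field` (bookkeeping). [ours; elementary] -/
theorem vorticityMoment_zero_field (i j : Fin 3) :
    vorticityMoment (fun _ : UnitAddTorus (Fin 3) => (0 : EuclideanSpace ℝ (Fin 3))) i j = 0 := by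
  simp [vorticityMoment, vorticityComp_zero_field]

/-- `enstrophyProduction_zero_field` (bookkeeping). [ours; elementary] -/
theorem enstrophyProduction_zero_field :
    enstrophyProduction (fun _ : UnitAddTorus (Fin 3) => (0 : EuclideanSpace ℝ (Fin 3))) = 0 := by
  simp [enstrophyProduction, Torus.convect]

/-- `torusEnstrophy_zero_field` (bookkeeping). [ours; elementary] -/
theorem torusEnstrophy_zero_field :
    torusEnstrophy (fun _ : UnitAddTorus (Fin 3) => (0 : EuclideanSpace ℝ (Fin 3))) = 0 := by
  simp [torusEnstrophy, Torus.gradNormSq, Torus.partialDeriv, Torus.lineDeriv]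

/-- `isDivFree_zero_field` (bookkeeping). [ours; elementary] -/
theorem isDivFree_zero_field :
    Torus.IsDivFree (fun _ : UnitAddTorus (Fin 3) => (0 : EuclideanSpace ℝ (Fin 3))) := by
  intro x
  simp [Torus.divergence, Torus.partialDeriv, Torus.lineDeriv]

/-- **One-sided wrap inequality at tolerance `ε`:** `wrapFloorPlus ε ≤ C` for `0 < ε` and every
valid `C` (N1 at `Λ₊` with `u₋ := 0`). [ours] -/
theorem wrapFloorPlus_le_of_wrapIdentity (hW : WrapIdentityBound) (hP : ConfinedPlus)
    {ε : ℝ} (hε : 0 < ε) {C : ℝ} (hB : StretchingSupBound (d := Fin 3) C) :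
    wrapFloorPlus ε ≤ C := by
  have hC := hB.nonneg
  obtain ⟨δ, hδ, hδ', up, hup, hupd, hups, hupω, hupσ, hupE, hupT⟩ := hP ε hε
  have key := hW lambdaPlus lambdaPlus_pos lambdaPlus_le_half δ hδ hδ' up
    (fun _ => (0 : EuclideanSpace ℝ (Fin 3))) hup hupd (Torus.isSmooth_const _) isDivFree_zero_field
    hups (fun _ _ => rfl) hupω (fun x => by rw [torusVorticitySqAt_zero_field]; norm_num) C hC hB
  rw [vorticityMoment_zero_field, vorticityMoment_zero_field, enstrophyProduction_zero_field,
    torusEnstrophy_zero_field] at key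
  have hΛ := lambdaPlus_pos
  have hD' : 0 < lambdaPlus ^ 2 + 1 / 8 + ε := by positivity
  unfold wrapFloorPlus
  rw [div_le_iff₀ hD']
  have hEp := torusEnstrophy_nonneg up
  nlinarith [mul_le_mul_of_nonneg_left hupT hΛ.le, mul_le_mul_of_nonneg_left hupE hC]

/-- **A2 (bank blueprint §1/§7, NEW one-sided variant): `WrapIdentityBound → ConfinedPlus → (4+3√2)/16 ≤ C⋆`.**
Loading only the `+` strain cells already beats `1/2`. Search for candidate a priori estimates; no regularity
claim. [ours] -/
theorem oneSided_le_stretchingSupConst_of_wrapIdentity (hW : WrapIdentityBound) (hP : ConfinedPlus) :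
    (4 + 3 * Real.sqrt 2) / 16 ≤ stretchingSupConst (d := Fin 3) := by
  refine le_of_forall_lt_imp_le_of_dense fun C hC => le_stretchingSupConst fun hB => ?_
  have ht : Tendsto wrapFloorPlus (𝓝[>] 0) (𝓝 (wrapFloorPlus 0)) :=
    continuousAt_wrapFloorPlus_zero.tendsto.mono_left nhdsWithin_le_nhds
  have hle : wrapFloorPlus 0 ≤ C := by
    refine le_of_tendsto ht ?_
    filter_upwards [Ioc_mem_nhdsGT (by norm_num : (0 : ℝ) < 1 / 16)] with ε hε
    exact wrapFloorPlus_le_of_wrapIdentity hW hP hε.1 hB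
  rw [wrapFloorPlus_zero] at hle
  exact absurd (hC.trans_le hle) (lt_irrefl C)

/-- `1/2 < (4+3√2)/16` (`⟺ 16 < 18`). [ours; elementary] -/
theorem half_lt_oneSided_const : (1 : ℝ) / 2 < (4 + 3 * Real.sqrt 2) / 16 := by
  have h2 : Real.sqrt 2 * Real.sqrt 2 = 2 := Real.mul_self_sqrt (by norm_num)
  nlinarith [Real.sqrt_nonneg 2]

/-- **The MINIMAL kernel route to strict separation: `WrapIdentityBound → ConfinedPlus → C_{2.5D} < C⋆`**
(with part 1's `stretchingSupConstOn_isTwoHalfD_le_half : C_{2.5D} ≤ 1/2`). Search for candidate a priori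
estimates; no regularity claim. [ours] -/
theorem stretchingSupConstOn_isTwoHalfD_lt_of_oneSided (hW : WrapIdentityBound) (hP : ConfinedPlus) :
    stretchingSupConstOn (IsTwoHalfD (d := Fin 3)) < stretchingSupConst (d := Fin 3) :=
  (stretchingSupConstOn_isTwoHalfD_le_half.trans_lt half_lt_oneSided_const).trans_le
    (oneSided_le_stretchingSupConst_of_wrapIdentity hW hP)

end Summit.NavierStokesRegularity.FunctionalMining

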